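import Literature.NumberTheory.LFunctions.RHInvZetaBound
import Literature.NumberTheory.LFunctions.NymanBeurling
import HarnessLib

/-!
# RH ⇒ `ζ(s) = O(t^ε)` and `1/ζ(s) = O(t^ε)` on `σ > 1/2` (Titchmarsh (14.2.5)–(14.2.6)): discharges

Topic: `Literature/NumberTheory/LFunctions`. The named facts
`Literature.NumberTheory.LFunctions.zeta_isBigO_rpow_of_riemannHypothesis` (Titchmarsh (14.2.5)) and
`Literature.NumberTheory.LFunctions.zeta_inv_isBigO_rpow_of_riemannHypothesis` (Titchmarsh (14.2.6)) of
`Literature/NumberTheory/LFunctions/NymanBeurling.lean` are proved here from the tree's complete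
proof of Littlewood's theorem in `Literature/NumberTheory/LFunctions/RHInvZetaBound.lean`
(`Literature.NumberTheory.LFunctions.InvZetaRH.norm_inv_riemannZeta_le_rpow` = (14.2.6), uniform in `σ ≥ σ₀ > 1/2`), whose
Borel–Carathéodory/three-circles bound `‖log ζ(σ+it)‖ ≤ ε log|t|` (`Literature.NumberTheory.LFunctions.InvZetaRH.norm_log_le_rpow`)
gives (14.2.5) by the same computation with `Re log ζ` in place of `-Re log ζ`.

## Main results (all proved)

* `Literature.NumberTheory.LFunctions.InvZetaRH.norm_riemannZeta_le_rpow` — (14.2.5), uniform: under RH, for `σ₀ > 1/2`,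
  `ε > 0` there is `T` with `‖ζ(σ+it)‖ ≤ |t|^ε` for `σ ≥ σ₀`, `|t| ≥ T`.
* `Literature.NumberTheory.LFunctions.InvZetaRH.exists_norm_inv_riemannZeta_le` — (14.2.6) on the whole closed half-plane
  `Re s ≥ σ₀ > 1/2`: `‖ζ(s)⁻¹‖ ≤ C (1 + |Im s|)^ε` (compactness near the real axis).
* `Literature.NumberTheory.LFunctions.zeta_isBigO_rpow_of_riemannHypothesis_holds` — discharge of the (14.2.5) fact.
* `Literature.NumberTheory.LFunctions.zeta_inv_isBigO_rpow_of_riemannHypothesis_holds` — discharge of the (14.2.6) fact.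

## References

* E. C. Titchmarsh, *The Theory of the Riemann Zeta-Function*, 2nd ed. (1986), Thm. 14.2 and
  eqs. (14.2.5)–(14.2.6).
-/

noncomputable section

open Complex Filter Topology Metric Set Asymptotics
open scoped Real

namespace Literature.NumberTheory.LFunctions

namespace InvZetaRH

/-- For `Re s ≥ 2`: `‖ζ(s)‖ ≤ 1 + ρ` (`ρ = ζ(2) - 1`). [folklore] -/
lemma norm_riemannZeta_le_of_two_le {s : ℂ} (hs : 2 ≤ s.re) : ‖riemannZeta s‖ ≤ 1 + rho := by
  have h := norm_riemannZeta_sub_one_le hs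
  have := norm_le_norm_add_norm_sub' (riemannZeta s) 1
  have h1 : ‖riemannZeta s‖ ≤ ‖(1 : ℂ)‖ + ‖riemannZeta s - 1‖ := by
    calc ‖riemannZeta s‖ = ‖1 + (riemannZeta s - 1)‖ := by ring_nf
      _ ≤ ‖(1 : ℂ)‖ + ‖riemannZeta s - 1‖ := norm_add_le _ _
  rw [norm_one] at h1
  linarith

/-- **Titchmarsh (14.2.5): under RH, `ζ(s) = O(t^ε)` for every `σ > 1/2`**, uniformly in
`σ ≥ σ₀ > 1/2`: for every `σ₀ > 1/2` and `ε > 0` there is `T` with `‖ζ(σ+it)‖ ≤ |t|^ε` for all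
`σ ≥ σ₀`, `|t| ≥ T`. Proof (Titchmarsh §14.2): with `δ = min((σ₀ − 1/2)/2, 1/2)`, (14.2.2)
(`exists_log_riemannZeta`) and the three-circles step (`norm_log_le_rpow`) give
`log|ζ(σ+it)| = Re L ≤ ‖L(σ+it)‖ ≤ B₂ (A₃δ⁻¹ log|t|)^{a₀} ≤ ε log|t|` for `log|t|` large (as
`a₀ < 1`) when `σ ≤ 5/2`; for `σ ≥ 5/2`, `‖ζ‖ ≤ 1 + ρ`.
[cite: Titchmarsh1986, Thm 14.2, eq. (14.2.5)] -/
theorem norm_riemannZeta_le_rpow (hRH : RiemannHypothesis) {σ₀ : ℝ} (hσ₀ : 1 / 2 < σ₀)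
    {ε : ℝ} (hε : 0 < ε) :
    ∃ T : ℝ, ∀ σ t : ℝ, σ₀ ≤ σ → T ≤ |t| → ‖riemannZeta (σ + t * I)‖ ≤ |t| ^ ε := by
  set δ : ℝ := min ((σ₀ - 1 / 2) / 2) (1 / 2) with hδdef
  have hδ : 0 < δ := lt_min (by linarith) (by norm_num)
  have hδ2 : δ ≤ 1 / 2 := min_le_right _ _
  have hσδ : 1 / 2 + 2 * δ ≤ σ₀ := by
    have := min_le_left ((σ₀ - 1 / 2) / 2) (1 / 2)
    rw [← hδdef] at this
    linarith
  set K : ℝ := A₃ / δ with hK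
  have hK40 : 40 ≤ K := forty_le_A₃_div hδ hδ2
  set a : ℝ := a₀ δ with ha
  have ha1 : a < 1 := a₀_lt_one hδ hδ2
  have ha0 : 0 ≤ a := a₀_nonneg hδ hδ2
  have hB₂ := one_le_B₂
  set Y : ℝ := (B₂ * K / ε) ^ (1 / (1 - a)) with hY
  have hY0 : 0 ≤ Y := Real.rpow_nonneg (by positivity) _
  have hρ := rho_lt_one
  have hρ0 := rho_pos
  set T : ℝ := max (max 7 (Real.exp Y)) ((1 + rho) ^ (1 / ε)) with hT
  refine ⟨T, fun σ t hσ ht => ?_⟩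
  have ht7 : 7 ≤ |t| := le_trans (le_max_left _ _) (le_trans (le_max_left _ _) ht)
  have htY : Real.exp Y ≤ |t| := le_trans (le_max_right _ _) (le_trans (le_max_left _ _) ht)
  have htρ : (1 + rho) ^ (1 / ε) ≤ |t| := le_trans (le_max_right _ _) ht
  have htpos : 0 < |t| := by linarith
  have hlog1 : 1 ≤ Real.log |t| := one_le_log_abs ht7
  have hlogY : Y ≤ Real.log |t| := (Real.le_log_iff_exp_le htpos).mpr htY
  by_cases hσ5 : σ ≤ 5 / 2
  · obtain ⟨L, hLd, hexp, hV, hM₃⟩ := exists_log_riemannZeta hRH hδ hδ2 ht7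
    set z : ℂ := σ + t * I with hzdef
    have hzball : z ∈ ball (ctr t) (R₀ δ) := by
      have hzc : z - ctr t = ((σ - 3 : ℝ) : ℂ) := by
        simp only [hzdef, ctr]; push_cast; ring
      rw [mem_ball, dist_eq_norm, hzc, Complex.norm_real, Real.norm_eq_abs,
        abs_of_nonpos (by linarith)]
      unfold R₀; linarith
    have hLz : ‖L z‖ ≤ B₂ * (K * Real.log |t|) ^ a :=
      norm_log_le_rpow hδ hδ2 ht7 hLd hV hM₃ (hσδ.trans hσ) hσ5
    -- `B₂ (K log|t|)^a ≤ ε log|t|`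
    have hK1 : 1 ≤ K := by linarith
    have hKa : (K * Real.log |t|) ^ a ≤ K * Real.log |t| ^ a := by
      rw [Real.mul_rpow (by linarith) (by linarith)]
      gcongr
      calc K ^ a ≤ K ^ (1 : ℝ) := Real.rpow_le_rpow_of_exponent_le hK1 ha1.le
        _ = K := Real.rpow_one K
    have hpow : B₂ * K / ε ≤ Real.log |t| ^ (1 - a) := by
      have h1 : Y ^ (1 - a) = B₂ * K / ε := by
        rw [hY, ← Real.rpow_mul (by positivity), one_div_mul_cancel (by linarith), Real.rpow_one]
      rw [← h1]
      exact Real.rpow_le_rpow hY0 hlogY (by linarith)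
    have hsplit : Real.log |t| = Real.log |t| ^ a * Real.log |t| ^ (1 - a) := by
      rw [← Real.rpow_add (by linarith)]; norm_num
    have hmain : B₂ * (K * Real.log |t| ^ a) ≤ ε * Real.log |t| := by
      have hla : 0 ≤ Real.log |t| ^ a := Real.rpow_nonneg (by linarith) _
      calc B₂ * (K * Real.log |t| ^ a) = (B₂ * K / ε) * ε * Real.log |t| ^ a := by
            field_simp
        _ ≤ Real.log |t| ^ (1 - a) * ε * Real.log |t| ^ a := by gcongr
        _ = ε * (Real.log |t| ^ a * Real.log |t| ^ (1 - a)) := by ring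
        _ = ε * Real.log |t| := by rw [← hsplit]
    have hLz' : ‖L z‖ ≤ ε * Real.log |t| := by
      calc ‖L z‖ ≤ B₂ * (K * Real.log |t|) ^ a := hLz
        _ ≤ B₂ * (K * Real.log |t| ^ a) := by gcongr
        _ ≤ ε * Real.log |t| := hmain
    -- `‖ζ(z)‖ = exp(Re L z) ≤ exp ‖L z‖ ≤ |t|^ε`
    rw [← hexp z hzball, norm_exp, Real.rpow_def_of_pos htpos]
    refine Real.exp_le_exp.mpr ?_
    have : (L z).re ≤ ‖L z‖ := re_le_norm (L z)
    nlinarith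
  · -- `σ > 5/2`: `‖ζ‖ ≤ 1 + ρ ≤ |t|^ε`
    have hσ2 : 2 ≤ ((σ : ℂ) + t * I).re := by simp; linarith
    refine (norm_riemannZeta_le_of_two_le hσ2).trans ?_
    have hbase : 0 ≤ 1 + rho := by linarith
    calc 1 + rho = ((1 + rho) ^ (1 / ε)) ^ ε := by
          rw [← Real.rpow_mul hbase, one_div_mul_cancel hε.ne', Real.rpow_one]
      _ ≤ |t| ^ ε := Real.rpow_le_rpow (Real.rpow_nonneg hbase _) htρ hε.le

/-- `ζ(s)⁻¹ → 0` as `s → 1` (simple pole; Mathlib `riemannZeta_residue_one`). [folklore] -/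
lemma tendsto_inv_riemannZeta_one :
    Tendsto (fun s : ℂ ↦ (riemannZeta s)⁻¹) (𝓝[≠] 1) (𝓝 0) := by
  have h1 : Tendsto (fun s : ℂ ↦ s - 1) (𝓝[≠] (1 : ℂ)) (𝓝 0) := by
    have : Tendsto (fun s : ℂ ↦ s - 1) (𝓝 (1 : ℂ)) (𝓝 (1 - 1)) :=
      (continuous_id.sub continuous_const).tendsto 1
    rw [sub_self] at this
    exact this.mono_left nhdsWithin_le_nhds
  have h2 := riemannZeta_residue_one
  have h3 := h1.mul (h2.inv₀ one_ne_zero)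
  rw [inv_one, zero_mul] at h3
  refine h3.congr' ?_
  filter_upwards [self_mem_nhdsWithin] with s hs
  have hs1 : s - 1 ≠ 0 := sub_ne_zero.2 hs
  simp only [mul_inv, ← mul_assoc, mul_inv_cancel₀ hs1, one_mul]

/-- **(14.2.6) on the closed half-plane.** Under RH, for `σ₀ > 1/2` and `ε > 0` there is `C > 0`
with `‖ζ(s)⁻¹‖ ≤ C (1 + |Im s|)^ε` for all `s` with `Re s ≥ σ₀` (for `|Im s|` large this is
`norm_inv_riemannZeta_le_rpow`; on the compact remainder with `Re s ≤ 2`, `ζ⁻¹` extended by `0`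
at the pole is continuous, and `‖ζ⁻¹‖ ≤ (1-ρ)⁻¹` for `Re s ≥ 2`).
[cite: Titchmarsh1986, Thm 14.2, eq. (14.2.6)] -/
theorem exists_norm_inv_riemannZeta_le (hRH : RiemannHypothesis) {σ₀ : ℝ} (hσ₀ : 1 / 2 < σ₀)
    {ε : ℝ} (hε : 0 < ε) :
    ∃ C : ℝ, 0 < C ∧ ∀ s : ℂ, σ₀ ≤ s.re → ‖(riemannZeta s)⁻¹‖ ≤ C * (1 + |s.im|) ^ ε := by
  obtain ⟨T, hT⟩ := norm_inv_riemannZeta_le_rpow hRH hσ₀ hε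
  set T' : ℝ := max T 1 with hT'
  -- the compact box `σ₀ ≤ re ≤ 2`, `|im| ≤ T'`
  set Kb : Set ℂ := Icc σ₀ 2 ×ℂ Icc (-T') T' with hKb
  have hKc : IsCompact Kb :=
    Metric.isCompact_of_isClosed_isBounded (isClosed_Icc.reProdIm isClosed_Icc)
      ((Metric.isBounded_Icc σ₀ 2).reProdIm (Metric.isBounded_Icc (-T') T'))
  set g : ℂ → ℂ := Function.update (fun s ↦ (riemannZeta s)⁻¹) 1 0 with hg
  have hgc : ContinuousOn g Kb := by
    intro s hs
    refine ContinuousAt.continuousWithinAt ?_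
    by_cases hs1 : s = 1
    · subst hs1
      rw [hg, continuousAt_update_same]
      exact tendsto_inv_riemannZeta_one
    · have hne : ∀ᶠ z in 𝓝 s, z ≠ 1 := isOpen_compl_singleton.eventually_mem hs1
      have heq : g =ᶠ[𝓝 s] fun z ↦ (riemannZeta z)⁻¹ := by
        filter_upwards [hne] with z hz
        rw [hg, Function.update_of_ne hz]
      refine (ContinuousAt.congr ?_ heq.symm)
      have hsre : 1 / 2 < s.re := by
        have : σ₀ ≤ s.re := hs.1.1
        linarith
      exact ((differentiableAt_riemannZeta hs1).continuousAt).inv₀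
        (riemannZeta_ne_zero_of_RH hRH hsre)
  obtain ⟨B, hB⟩ := hKc.exists_bound_of_continuousOn hgc
  have hρ := rho_lt_one
  set C : ℝ := max (max B ‖(riemannZeta 1)⁻¹‖) (max (1 - rho)⁻¹ 1) with hC
  have hC1 : 1 ≤ C := le_trans (le_max_right _ _) (le_max_right _ _)
  refine ⟨C, by linarith, fun s hs ↦ ?_⟩
  have h1 : 1 ≤ (1 + |s.im|) ^ ε := Real.one_le_rpow (by linarith [abs_nonneg s.im]) hε.le
  have hCle : ∀ {x : ℝ}, x ≤ C → x ≤ C * (1 + |s.im|) ^ ε := fun hx ↦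
    hx.trans (le_mul_of_one_le_right (by linarith) h1)
  rcases le_or_gt T' |s.im| with him | him
  · -- large `|t|`
    have hsT : T ≤ |s.im| := le_trans (le_max_left _ _) him
    have h := hT s.re s.im hs hsT
    rw [re_add_im] at h
    refine h.trans ?_
    calc |s.im| ^ ε ≤ (1 + |s.im|) ^ ε :=
          Real.rpow_le_rpow (abs_nonneg _) (by linarith) hε.le
      _ ≤ C * (1 + |s.im|) ^ ε := le_mul_of_one_le_left (by positivity) hC1
  · rcases le_or_gt 2 s.re with h2 | h2
    · exact hCle ((norm_inv_riemannZeta_le_of_two_le h2).trans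
        ((le_max_left _ _).trans (le_max_right _ _)))
    · have hsK : s ∈ Kb := ⟨⟨hs, h2.le⟩, abs_le.1 him.le⟩
      by_cases hs1 : s = 1
      · subst hs1
        exact hCle ((le_max_right _ _).trans (le_max_left _ _))
      · have := hB s hsK
        rw [hg, Function.update_of_ne hs1] at this
        exact hCle (this.trans ((le_max_left _ _).trans (le_max_left _ _)))

end InvZetaRH

section RH

/-- **Discharge of `Literature.NumberTheory.LFunctions.zeta_isBigO_rpow_of_riemannHypothesis`** (Titchmarsh (14.2.5)): under
RH, `ζ(σ+it) = O(t^ε)` as `t → +∞` for every `σ > 1/2`, `ε > 0`.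
[cite: Titchmarsh1986, Thm 14.2, eq. (14.2.5)] -/
theorem zeta_isBigO_rpow_of_riemannHypothesis_holds : zeta_isBigO_rpow_of_riemannHypothesis := by
  intro hRH σ ε hσ hε
  obtain ⟨T, hT⟩ := InvZetaRH.norm_riemannZeta_le_rpow hRH hσ hε
  refine IsBigO.of_bound 1 ?_
  filter_upwards [eventually_ge_atTop (max T 0)] with t ht
  have ht0 : 0 ≤ t := le_trans (le_max_right _ _) ht
  have htT : T ≤ |t| := by rw [abs_of_nonneg ht0]; exact le_trans (le_max_left _ _) ht
  have h := hT σ t le_rfl htT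
  rw [abs_of_nonneg ht0] at h
  rwa [one_mul, Real.norm_of_nonneg (Real.rpow_nonneg ht0 _)]

/-- **Discharge of `Literature.NumberTheory.LFunctions.zeta_inv_isBigO_rpow_of_riemannHypothesis`** (Titchmarsh (14.2.6)):
under RH, `1/ζ(σ+it) = O(t^ε)` as `t → +∞` for every `σ > 1/2`, `ε > 0`; from the tree's
`Literature.NumberTheory.LFunctions.InvZetaRH.norm_inv_riemannZeta_le_rpow`. [cite: Titchmarsh1986, Thm 14.2, eq. (14.2.6)] -/
theorem zeta_inv_isBigO_rpow_of_riemannHypothesis_holds :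
    zeta_inv_isBigO_rpow_of_riemannHypothesis := by
  intro hRH σ ε hσ hε
  obtain ⟨T, hT⟩ := InvZetaRH.norm_inv_riemannZeta_le_rpow hRH hσ hε
  refine IsBigO.of_bound 1 ?_
  filter_upwards [eventually_ge_atTop (max T 0)] with t ht
  have ht0 : 0 ≤ t := le_trans (le_max_right _ _) ht
  have htT : T ≤ |t| := by rw [abs_of_nonneg ht0]; exact le_trans (le_max_left _ _) ht
  have h := hT σ t le_rfl htT
  rw [abs_of_nonneg ht0] at h
  rwa [one_mul, Real.norm_of_nonneg (Real.rpow_nonneg ht0 _)]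

end RH

end Literature.NumberTheory.LFunctions

end
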